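import Mathlib
import Summits.QuantumAdvantage.AdviceFreeQNC0.OddPrimeStatements
import Summits.QuantumAdvantage.AdviceFreeQNC0.OddPrimeWitnesses
import Summits.QuantumAdvantage.AdviceFreeQNC0.WalkFailFloor
import Literature.Computability.MetaComplexity.RazborovSmolenskyPoly

set_option linter.dupNamespace false

/-!
# AbsorptionDial (F) — degree two is decided, and it separates `p = 3` from `p ≥ 5` (cell decomp-qadv, lens 4, g14 rev 5)

Prop-definition-free continuation of `AbsorptionDialA–E` (independent of them; supports of the degree axis of
`X = NoPerfectPolyOdd`, item stmt-QuantumAdvantage-28487 of route-QuantumAdvantage-AbsorptionDial, and of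
stmt-QuantumAdvantage-26994 ≡ 26767):

* `moeb`, `moeb_insert`, **`sum_moeb`** (Möbius inversion on the Boolean lattice, by insertion induction), `moeb_unique`,
  `moeb_subsetIndicator` — Möbius coefficients of set functions over a commutative ring.
* **`moeb_eq_zero_of_mem_lowDeg`** / **`hasDegF_iff_dvd_cZ`** / `hasDeg_iff_dvd_cZ` — the EXACT COEFFICIENT CRITERION:
  with `cZ f S = Σ_{T ⊆ S} (−1)^{|S∖T|} [f(1_T)] ∈ ℤ` the integer multilinear coefficients of a Boolean `f`,
  `HasDegF p f D ↔ (p ∣ cZ f S for all |S| > D)` (span induction one way, reconstruction `ind_mem_lowDeg_of_cZ` the other).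
* **`cZ_eq_zero_of_dvd`** — the elementary DEGREE-TWO TRANSFER: if an integer `N ≥ 5` divides `cZ f S` for all `|S| ≥ 3`
  then all these coefficients VANISH (strong induction on `S`: the truncated quadratic part is Boolean below the top of
  the cube `S`, its discrete derivative is an affine form with values in `{−1,0,1}` below the top, forcing `|cZ f S| ≤ 4`).
  Sharp in `N`: `MOD₃` of three bits has `c_{123} = −3`.
* `cZ_eq_zero_of_hasDegF_two`, **`hasDeg_two_of_hasDegF_two`** (`p ≥ 5`: `𝔽_p`-degree ≤ 2 ⟹ `𝔽₂`-degree ≤ 2),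
  `hasDegF_two_transfer` (… ⟹ degree ≤ 2 over every prime field).
* **`degTwo_fail_floor`** — for a prime `p ≥ 5`, `n ≥ 7`, every charge: a strategy vector of `𝔽_p`-cut-degree `≤ 2`
  loses the u-walk game on `≥ 2^{n−7}` inputs (the `𝔽₂` cell's `WalkFailFloor.ringWinU_fail_floor` transferred);
  `degTwo_win_le`.  **`degTwo_perfect_three`** — at `p = 3` the same degree is PERFECT (`walkEasyThree`): the first
  fail-floor statement that separates `p = 3` from `p ≥ 5`.

0 sorry · no new axioms · no instance / notation / native_decide.
-/

open Finset
open Literature.Computability.MetaComplexity Literature.Computability.MetaComplexity.Smolensky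
open Summit.QuantumAdvantage.AdviceFreeQNC0

namespace Summit.QuantumAdvantage.QuantumAdvantage.Theorems.AbsorptionDial

/-! ### Möbius coefficients of a set function -/

section Moebius

variable {α : Type*} {R : Type*} [CommRing R]

/-- the Möbius transform `v̂(S) = Σ_{T ⊆ S} (−1)^{|S|−|T|} v(T)`. -/
def moeb (v : Finset α → R) (S : Finset α) : R :=
  ∑ T ∈ S.powerset, (-1 : R) ^ (S.card - T.card) * v T

/-- AbsorptionDialF helper `moeb_add` (decomp-qadv land package; see the module docstring). -/
theorem moeb_add (v w : Finset α → R) (S : Finset α) : moeb (v + w) S = moeb v S + moeb w S := by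
  simp only [moeb, Pi.add_apply, mul_add, Finset.sum_add_distrib]

/-- AbsorptionDialF helper `moeb_smul` (decomp-qadv land package; see the module docstring). -/
theorem moeb_smul (c : R) (v : Finset α → R) (S : Finset α) : moeb (c • v) S = c * moeb v S := by
  simp only [moeb, Pi.smul_apply, smul_eq_mul, Finset.mul_sum]
  exact Finset.sum_congr rfl fun T _ => by ring

/-- AbsorptionDialF helper `moeb_zero` (decomp-qadv land package; see the module docstring). -/
theorem moeb_zero (S : Finset α) : moeb (0 : Finset α → R) S = 0 := by
  simp [moeb]

/-- insertion: `v̂(S ∪ {a}) = (Δₐv)̂(S)` with `Δₐ v (U) = v (U ∪ {a}) − v U`. -/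
theorem moeb_insert [DecidableEq α] (v : Finset α → R) {a : α} {S : Finset α} (ha : a ∉ S) :
    moeb v (insert a S) = moeb (fun U => v (insert a U)) S - moeb v S := by
  unfold moeb
  rw [Finset.sum_powerset_insert ha, Finset.card_insert_of_notMem ha]
  have h1 : ∑ T ∈ S.powerset, (-1 : R) ^ (S.card + 1 - T.card) * v T =
      -(∑ T ∈ S.powerset, (-1 : R) ^ (S.card - T.card) * v T) := by
    rw [← Finset.sum_neg_distrib]
    refine Finset.sum_congr rfl fun T hT => ?_
    have hle : T.card ≤ S.card := Finset.card_le_card (Finset.mem_powerset.1 hT)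
    rw [show S.card + 1 - T.card = (S.card - T.card) + 1 by omega, pow_succ]
    ring
  have h2 : ∑ T ∈ S.powerset, (-1 : R) ^ (S.card + 1 - (insert a T).card) * v (insert a T) =
      ∑ T ∈ S.powerset, (-1 : R) ^ (S.card - T.card) * v (insert a T) := by
    refine Finset.sum_congr rfl fun T hT => ?_
    have haT : a ∉ T := fun h => ha (Finset.mem_powerset.1 hT h)
    rw [Finset.card_insert_of_notMem haT]
    have hle : T.card ≤ S.card := Finset.card_le_card (Finset.mem_powerset.1 hT)
    rw [show S.card + 1 - (T.card + 1) = S.card - T.card by omega]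
  rw [h1, h2]
  ring

/-- **Möbius inversion**: `v(X) = Σ_{T ⊆ X} v̂(T)`. -/
theorem sum_moeb [DecidableEq α] (v : Finset α → R) (X : Finset α) : ∑ T ∈ X.powerset, moeb v T = v X := by
  induction X using Finset.induction_on generalizing v with
  | empty => simp [moeb]
  | insert a X ha ih =>
    rw [Finset.sum_powerset_insert ha, ih v]
    have h : ∑ T ∈ X.powerset, moeb v (insert a T) = ∑ T ∈ X.powerset, moeb (fun U => v (insert a U) - v U) T := by
      refine Finset.sum_congr rfl fun T hT => ?_
      have haT : a ∉ T := fun h => ha (Finset.mem_powerset.1 hT h)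
      rw [moeb_insert v haT]
      have : (fun U => v (insert a U) - v U) = (fun U => v (insert a U)) + (-1 : R) • v := by
        funext U; simp [sub_eq_add_neg]
      rw [this, moeb_add, moeb_smul]
      ring
    rw [h, ih (fun U => v (insert a U) - v U)]
    ring

/-- uniqueness: any `w` with `v(X) = Σ_{T ⊆ X} w(T)` is `v̂`. -/
theorem moeb_unique [DecidableEq α] (v w : Finset α → R) (h : ∀ X, ∑ T ∈ X.powerset, w T = v X) (S : Finset α) :
    w S = moeb v S := by
  induction S using Finset.strongInduction with
  | H S ih =>
    have hS : S ∈ S.powerset := Finset.mem_powerset.2 (subset_refl S)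
    have hw := h S
    have hm := sum_moeb v S
    rw [← Finset.add_sum_erase _ _ hS] at hw hm
    have heq : ∑ T ∈ S.powerset.erase S, w T = ∑ T ∈ S.powerset.erase S, moeb v T :=
      Finset.sum_congr rfl fun T hT => by
        have hTS : T ⊂ S := by
          obtain ⟨hne, hT'⟩ := Finset.mem_erase.1 hT
          exact lt_of_le_of_ne (Finset.mem_powerset.1 hT') hne
        exact ih T hTS
    rw [heq] at hw
    rw [← hm] at hw
    exact add_right_cancel hw

/-- the Möbius transform of the indicator `T ↦ [U ⊆ T]` is `δ_U`. -/
theorem moeb_subsetIndicator [DecidableEq α] (U S : Finset α) :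
    moeb (fun T => if U ⊆ T then (1 : R) else 0) S = if S = U then 1 else 0 := by
  symm
  refine moeb_unique (fun T => if U ⊆ T then (1 : R) else 0) (fun T => if T = U then 1 else 0) (fun X => ?_) S
  rw [Finset.sum_ite_eq']
  simp only [Finset.mem_powerset]

end Moebius


/-! ### The coefficient criterion for `lowDeg` -/

section Cube

variable {n : ℕ}

/-- the input `1_T`. -/
def bitsOf (T : Finset (Fin n)) : Fin n → Bool := fun j => decide (j ∈ T)

/-- the support of an input. -/
def suppOf (x : Fin n → Bool) : Finset (Fin n) := Finset.univ.filter fun i => x i = true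

/-- AbsorptionDialF helper `bitsOf_apply` (decomp-qadv land package; see the module docstring). -/
@[simp] theorem bitsOf_apply (T : Finset (Fin n)) (j : Fin n) : bitsOf T j = decide (j ∈ T) := rfl

/-- AbsorptionDialF helper `mem_suppOf` (decomp-qadv land package; see the module docstring). -/
@[simp] theorem mem_suppOf (x : Fin n → Bool) (i : Fin n) : i ∈ suppOf x ↔ x i = true := by
  simp [suppOf]

/-- AbsorptionDialF helper `bitsOf_suppOf` (decomp-qadv land package; see the module docstring). -/
theorem bitsOf_suppOf (x : Fin n → Bool) : bitsOf (suppOf x) = x := by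
  funext j; cases h : x j <;> simp [h]

/-- AbsorptionDialF helper `mono_bitsOf` (decomp-qadv land package; see the module docstring). -/
theorem mono_bitsOf {F : Type*} [Field F] (U T : Finset (Fin n)) :
    mono F U (bitsOf T) = if U ⊆ T then 1 else 0 := by
  by_cases h : U ⊆ T
  · rw [if_pos h, mono_apply, if_pos]
    intro i hi; simpa using h hi
  · rw [if_neg h, mono_apply, if_neg]
    intro h'
    exact h fun i hi => by simpa using h' i hi

/-- **coefficient criterion**: the Möbius coefficients of a function of degree `≤ D` vanish above `D`
(span induction: linear in the function, and the transform of the generator `x_U`, `|U| ≤ D`, is `δ_U`). -/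
theorem moeb_eq_zero_of_mem_lowDeg {F : Type*} [Field F] {D : ℕ} {h : CubeFn F n} (hh : h ∈ lowDeg F n D)
    {S : Finset (Fin n)} (hS : D < S.card) : moeb (fun T => h (bitsOf T)) S = 0 := by
  induction hh using Submodule.span_induction with
  | mem g hg =>
    obtain ⟨⟨U, hU⟩, rfl⟩ := hg
    have hfun : (fun T => mono F U (bitsOf T)) = fun T => if U ⊆ T then (1 : F) else 0 :=
      funext fun T => mono_bitsOf U T
    rw [hfun, moeb_subsetIndicator, if_neg]
    rintro rfl
    exact absurd hU (by simpa using hS)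
  | zero => simp [moeb]
  | add g₁ g₂ _ _ ih₁ ih₂ =>
    have : (fun T => (g₁ + g₂) (bitsOf T)) = (fun T => g₁ (bitsOf T)) + fun T => g₂ (bitsOf T) := rfl
    rw [this, moeb_add, ih₁, ih₂, add_zero]
  | smul c g _ ih =>
    have : (fun T => (c • g) (bitsOf T)) = c • fun T => g (bitsOf T) := rfl
    rw [this, moeb_smul, ih, mul_zero]

/-! ### Integer Möbius coefficients of a Boolean function -/

/-- the `0/1` value of `f` at `1_T`, as an integer. -/
def fv (f : (Fin n → Bool) → Bool) (T : Finset (Fin n)) : ℤ := if f (bitsOf T) then 1 else 0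

/-- the integer Möbius (multilinear) coefficient `c_S(f)`. -/
def cZ (f : (Fin n → Bool) → Bool) (S : Finset (Fin n)) : ℤ := moeb (fv f) S

/-- AbsorptionDialF helper `fv_nonneg` (decomp-qadv land package; see the module docstring). -/
theorem fv_nonneg (f : (Fin n → Bool) → Bool) (T : Finset (Fin n)) : 0 ≤ fv f T := by
  unfold fv; split_ifs <;> norm_num

/-- AbsorptionDialF helper `fv_le_one` (decomp-qadv land package; see the module docstring). -/
theorem fv_le_one (f : (Fin n → Bool) → Bool) (T : Finset (Fin n)) : fv f T ≤ 1 := by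
  unfold fv; split_ifs <;> norm_num

/-- inversion: `[f(1_X)] = Σ_{T ⊆ X} c_T(f)`. -/
theorem sum_cZ (f : (Fin n → Bool) → Bool) (X : Finset (Fin n)) : ∑ T ∈ X.powerset, cZ f T = fv f X :=
  sum_moeb (fv f) X

/-- the coefficient over a ring is the cast of the integer coefficient. -/
theorem cast_cZ (F : Type*) [CommRing F] (f : (Fin n → Bool) → Bool) (S : Finset (Fin n)) :
    ((cZ f S : ℤ) : F) = moeb (fun T => if f (bitsOf T) then (1 : F) else 0) S := by
  simp only [cZ, moeb, fv, Int.cast_sum, Int.cast_mul, Int.cast_pow, Int.cast_neg, Int.cast_one]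
  refine Finset.sum_congr rfl fun T _ => ?_
  split_ifs <;> simp

/-- `HasDegF p f D` forces `p ∣ c_S(f)` for `|S| > D`. -/
theorem dvd_cZ_of_hasDegF {p : ℕ} [Fact p.Prime] {f : (Fin n → Bool) → Bool} {D : ℕ} (hf : HasDegF p f D)
    {S : Finset (Fin n)} (hS : D < S.card) : (p : ℤ) ∣ cZ f S := by
  have h0 := moeb_eq_zero_of_mem_lowDeg (F := ZMod p) hf hS
  rw [← cast_cZ] at h0
  exact (ZMod.intCast_zmod_eq_zero_iff_dvd _ _).1 h0

/-- reconstruction: if the coefficients above `D` vanish in the field `F`, the `F`-indicator of `f` is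
`Σ_{|S| ≤ D} c_S · x_S ∈ lowDeg F n D`. -/
theorem ind_mem_lowDeg_of_cZ {F : Type*} [Field F] [DecidableEq F] {f : (Fin n → Bool) → Bool} {D : ℕ}
    (h : ∀ S : Finset (Fin n), D < S.card → ((cZ f S : ℤ) : F) = 0) :
    (fun x => if f x then (1 : F) else 0) ∈ lowDeg F n D := by
  set g : CubeFn F n :=
    ∑ S ∈ (Finset.univ : Finset (Finset (Fin n))).filter (fun S => S.card ≤ D), ((cZ f S : ℤ) : F) • mono F S
    with hg
  have hmem : g ∈ lowDeg F n D := by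
    refine Submodule.sum_mem _ fun S hS => Submodule.smul_mem _ _ (mono_mem_lowDeg ?_)
    exact (Finset.mem_filter.1 hS).2
  have heq : (fun x => if f x then (1 : F) else 0) = g := by
    funext x
    set X := suppOf x with hX
    have hx : x = bitsOf X := (bitsOf_suppOf x).symm
    -- the left side is the cast of `fv f X = Σ_{T ⊆ X} cZ f T`
    have hl : (if f x then (1 : F) else 0) = ∑ T ∈ X.powerset, ((cZ f T : ℤ) : F) := by
      rw [← Int.cast_sum, sum_cZ, fv, ← hx]
      split_ifs <;> simp
    have hl' : ∑ T ∈ X.powerset, ((cZ f T : ℤ) : F) =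
        ∑ T ∈ X.powerset.filter (fun S => S.card ≤ D), ((cZ f T : ℤ) : F) := by
      rw [Finset.sum_filter_of_ne]
      intro T _ hT
      by_contra hc
      exact hT (h T (by simpa using hc))
    have hr : g x = ∑ S ∈ (Finset.univ : Finset (Finset (Fin n))).filter (fun S => S.card ≤ D),
        (if S ⊆ X then ((cZ f S : ℤ) : F) else 0) := by
      rw [hg, Finset.sum_apply]
      refine Finset.sum_congr rfl fun S _ => ?_
      rw [Pi.smul_apply, smul_eq_mul, hx, mono_bitsOf, mul_ite, mul_one, mul_zero]
    rw [hl, hl', hr, Finset.sum_ite, Finset.sum_const_zero, add_zero]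
    refine Finset.sum_congr ?_ fun _ _ => rfl
    ext S
    simp only [Finset.mem_filter, Finset.mem_powerset, Finset.mem_univ, true_and]
    tauto
  rw [heq]; exact hmem


end Cube
end Summit.QuantumAdvantage.QuantumAdvantage.Theorems.AbsorptionDial
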